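import Summits.QuantumFields.YangMills.Theorems.BalabanUVNodesN15KingModelRenormalisationGroupFlow

/-!
# BalabanUVNodes ∕ N15 — THE KING-MODEL RUNG (PART Ϻ-dd): THE BLOCK-SPIN TRANSFORMATION AT THE LEVEL OF LAWS — `(R_Lφ)(z) = L^{−(d+3)∕2}Σ_{a∈[0,L)^{d+1}}φ(Lz + a)` pushes King's
# infinite-volume block field of mass `m` forward to the one of mass `Lm`: `(R_L)_*μ_{∞,m} = μ_{∞,Lm}`, `(R_L^n)_*μ_{∞,m} = μ_{∞,L^nm}`, and the massless field is a FIXED POINT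
# `(R_L)_*μ⁰_∞ = μ⁰_∞` (`d + 1 ≥ 3`) (Track A, DAG node N15 = NE2; FAN-OUT v1.1 §N15 s3 «KING-MODEL RUNG»; count-neutral)

HONEST FRAMING.  Count-neutral (cell `pub-ymgap`, seat `pub-ymgap-dag-n15-e` g35; `--supports stmt-QuantumFields-27366 --as helper` = K3⁸).  King's `A = 0`, `g = 0` model
([King1986] C. King, Commun. Math. Phys. **102** (1986) 649–677).  Part Ϻ-cc computed the covariance flow `Σ_{a,b}S₂^{ℝ}_{m²}(Lz + a − b) = L^{d+3}S₂^{ℝ}_{L²m²}(z)`.  Since all fields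
are centred Gaussian (Kolmogorov–Kallenberg uniqueness, the tree's `eq_gaussianFieldOfKernel_of_isGaussianProcess`), the flow lifts to the LAWS: with the block-spin map
`(R_Lφ)(z) = (L^{d+3})^{−1∕2}Σ_{a∈[0,L)^{d+1}}φ(Lz + a)` (block average `L^{−(d+1)}Σ_a` times the field rescaling `L^{(d−1)∕2}`),
★★★ **`(R_L)_*μ_{∞,m²} = μ_{∞,L²m²}`** — THE RENORMALISATION GROUP ACTS ON KING'S FREE BLOCK FIELDS BY `m ↦ Lm`; ★★ iterating, `(R_L^n)_*μ_{∞,m²} = μ_{∞,L^{2n}m²}`; and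
★★★ **`(R_L)_*μ⁰_∞ = μ⁰_∞`** — the massless block field (`d + 1 ≥ 3`, part Ϻ-x) is an exact fixed point of the block-spin renormalisation group, the Gaussian fixed point around
which King ∕ Gawędzki–Kupiainen ∕ Bałaban expand.  A generic push-forward lemma for `gaussianFieldOfKernel` under `R_L` is typed first.  NOT Bałaban's objects; NOT a node discharge;
nothing continuum-Yang–Mills ∕ `ℝ⁴` ∕ OS ∕ Clay.  0 `sorry`; 2 defs (`blockSite`, `blockRG`).

WHAT THIS FILE PROVES (kernel).  §1 defs `blockSite`, `blockRG`, `blockRG_apply`, `measurable_blockRG`, ★ `isGaussianProcess_blockRG`, ★★ **`map_blockRG_gaussianFieldOfKernel`** (generic).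
§2 `sum_sum_kingKernel_blockSite`, ★★★ **`kingFieldInf_map_blockRG`**, ★★ `kingFieldInf_map_blockRG_iterate`.  §3 `sum_sum_kingKernel0_blockSite`, ★★★ **`kingFieldInf0_map_blockRG`**, `kingFieldInf0_map_blockRG_iterate`.

HONEST SCOPE.  King's free `K = |Ω| = ∞` block fields at infinite volume; `L ≥ 1` integer scale factors.  N15 untouched; counts unmoved.
Locators (use): [King1986] §2 (2.3)–(2.6) p.652, Thm 2.1 (2.22) p.654; [Kallenberg2002] Lemma 13.1.
-/

noncomputable section

open scoped BigOperators Topology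
open Filter MeasureTheory ProbabilityTheory Finset

namespace Summit.QuantumFields.YangMills.BalabanUVNodes.N15KingModelRung.InfiniteVolume

open Literature.MathematicalPhysics.QuantumFieldTheory (IsPosSemidefKernel gaussianFieldOfKernel isProbabilityMeasure_gaussianFieldOfKernel
  isGaussianProcess_eval_gaussianFieldOfKernel integral_eval_gaussianFieldOfKernel covariance_eval_gaussianFieldOfKernel eq_gaussianFieldOfKernel_of_isGaussianProcess)
open Summit.QuantumFields.YangMills.BalabanUVNodes.N15KingModelRung.FreeField
open Summit.QuantumFields.YangMills.BalabanUVNodes.N15KingModelRung.OptimalDecay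
open Summit.QuantumFields.YangMills.BalabanUVNodes.N15KingModelRung.ProperTime

variable {d : ℕ}

/-! ## §1 The block-spin map and the generic push-forward lemma -/

/-- The sites of the `L`-block at `z`: `Lz + a`, `a ∈ [0,L)^{d+1}`. [cite: King1986, §2 (2.3) p.652] -/
def blockSite (L : ℕ) (z : Fin (d + 1) → ℤ) (a : Fin (d + 1) → Fin L) : Fin (d + 1) → ℤ := fun μ => (L : ℤ) * z μ + ((a μ : ℕ) : ℤ)

/-- **THE BLOCK-SPIN RENORMALISATION-GROUP MAP** `(R_Lφ)(z) = (L^{d+3})^{−1∕2}Σ_{a∈[0,L)^{d+1}}φ(Lz + a)` — the block average `L^{−(d+1)}Σ_a` followed by the field rescaling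
`L^{(d−1)∕2}`. [cite: King1986, §2 (2.3)–(2.6) p.652] -/
def blockRG (d L : ℕ) (ω : (Fin (d + 1) → ℤ) → ℝ) (z : Fin (d + 1) → ℤ) : ℝ :=
  (Real.sqrt ((L : ℝ) ^ (d + 3)))⁻¹ * ∑ a : Fin (d + 1) → Fin L, ω (blockSite L z a)

/-- `(R_Lφ)(z) = (L^{d+3})^{−1∕2}Σ_aφ(Lz + a)`. [folklore] -/
theorem blockRG_apply (L : ℕ) (ω : (Fin (d + 1) → ℤ) → ℝ) (z : Fin (d + 1) → ℤ) :
    blockRG d L ω z = (Real.sqrt ((L : ℝ) ^ (d + 3)))⁻¹ * ∑ a : Fin (d + 1) → Fin L, ω (blockSite L z a) := rfl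

/-- `R_L` is measurable for the product σ-algebras. [folklore] -/
theorem measurable_blockRG (d L : ℕ) : Measurable (blockRG d L) :=
  measurable_pi_lambda _ fun z => (Finset.measurable_sum _ fun a _ => measurable_pi_apply (blockSite L z a)).const_mul _

/-- ★ Under any centred Gaussian field `gaussianFieldOfKernel K`, the block-spin process `z ↦ (R_Lφ)(z)` is a Gaussian process (finite linear combinations of coordinates). [folklore] -/
theorem isGaussianProcess_blockRG {K : (Fin (d + 1) → ℤ) → (Fin (d + 1) → ℤ) → ℝ} (hK : IsPosSemidefKernel K) (L : ℕ) :
    IsGaussianProcess (fun (z : Fin (d + 1) → ℤ) (ω : (Fin (d + 1) → ℤ) → ℝ) => blockRG d L ω z) (gaussianFieldOfKernel K) := by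
  classical
  refine (isGaussianProcess_eval_gaussianFieldOfKernel hK).of_isGaussianProcess fun z => ?_
  refine ⟨(Finset.univ : Finset (Fin (d + 1) → Fin L)).image (blockSite L z),
    (Real.sqrt ((L : ℝ) ^ (d + 3)))⁻¹ • ∑ a : Fin (d + 1) → Fin L,
      ContinuousLinearMap.proj (R := ℝ) (φ := fun _ : ↥((Finset.univ : Finset (Fin (d + 1) → Fin L)).image (blockSite L z)) => ℝ)
        ⟨blockSite L z a, Finset.mem_image_of_mem _ (Finset.mem_univ a)⟩, fun ω => ?_⟩
  simp only [blockRG, FunLike.coe_smul, Pi.smul_apply, FunLike.coe_sum, Finset.sum_apply, ContinuousLinearMap.proj_apply,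
    Finset.restrict, smul_eq_mul]

/-- ★★ **GENERIC PUSH-FORWARD LEMMA**: if two positive-semidefinite kernels satisfy the block-flow identity `Σ_{a,b}K(Lz+a, Lw+b) = L^{d+3}K′(z,w)`, then `R_L` pushes the Gaussian field
of `K` forward to the Gaussian field of `K′`. [cite: Kallenberg2002, Lemma 13.1] -/
theorem map_blockRG_gaussianFieldOfKernel {K K' : (Fin (d + 1) → ℤ) → (Fin (d + 1) → ℤ) → ℝ} (hK : IsPosSemidefKernel K) (hK' : IsPosSemidefKernel K')
    {L : ℕ} (hL : 1 ≤ L)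
    (hflow : ∀ z w, ∑ a : Fin (d + 1) → Fin L, ∑ b : Fin (d + 1) → Fin L, K (blockSite L z a) (blockSite L w b) = (L : ℝ) ^ (d + 3) * K' z w) :
    (gaussianFieldOfKernel K).map (blockRG d L) = gaussianFieldOfKernel K' := by
  haveI := isProbabilityMeasure_gaussianFieldOfKernel hK
  have hTm := measurable_blockRG d L
  haveI : IsProbabilityMeasure ((gaussianFieldOfKernel K).map (blockRG d L)) := Measure.isProbabilityMeasure_map hTm.aemeasurable
  have hX := isGaussianProcess_eval_gaussianFieldOfKernel hK
  have hY := isGaussianProcess_blockRG hK L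
  have hLpos : (0 : ℝ) < (L : ℝ) ^ (d + 3) := by
    have : (0 : ℝ) < L := Nat.cast_pos.mpr (by omega)
    positivity
  refine eq_gaussianFieldOfKernel_of_isGaussianProcess hK' ?_ (fun s => ?_) (fun s t => ?_)
  · refine ⟨fun I => ⟨?_⟩⟩
    have hr : Measurable (fun ω : (Fin (d + 1) → ℤ) → ℝ => I.restrict fun x => ω x) := Finset.measurable_restrict I
    rw [Measure.map_map hr hTm]
    have hfun : ((fun ω : (Fin (d + 1) → ℤ) → ℝ => I.restrict fun x => ω x) ∘ blockRG d L)
        = fun ω => I.restrict fun z => blockRG d L ω z := by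
      funext ω; rfl
    rw [hfun]
    exact (hY.hasGaussianLaw I).isGaussian_map
  · rw [integral_map hTm.aemeasurable (measurable_pi_apply s).aestronglyMeasurable]
    change ∫ ω, blockRG d L ω s ∂gaussianFieldOfKernel K = 0
    simp only [blockRG]
    rw [integral_const_mul, integral_finsetSum _ fun a _ => (hX.hasGaussianLaw_eval _).integrable]
    simp [integral_eval_gaussianFieldOfKernel hK]
  · rw [covariance_map (measurable_pi_apply s).aestronglyMeasurable (measurable_pi_apply t).aestronglyMeasurable hTm.aemeasurable]
    change cov[fun ω => blockRG d L ω s, fun ω => blockRG d L ω t; gaussianFieldOfKernel K] = K' s t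
    simp only [blockRG]
    rw [covariance_const_mul_left, covariance_const_mul_right,
      covariance_fun_sum_fun_sum (fun a => (hX.hasGaussianLaw_eval _).memLp_two) (fun b => (hX.hasGaussianLaw_eval _).memLp_two)]
    have hcov : ∀ a b : Fin (d + 1) → Fin L,
        cov[fun ω : (Fin (d + 1) → ℤ) → ℝ => ω (blockSite L s a), fun ω => ω (blockSite L t b); gaussianFieldOfKernel K] = K (blockSite L s a) (blockSite L t b) :=
      fun a b => covariance_eval_gaussianFieldOfKernel hK _ _
    simp_rw [hcov]
    rw [hflow s t, ← mul_assoc, ← mul_inv, Real.mul_self_sqrt hLpos.le, inv_mul_cancel_left₀ hLpos.ne']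

/-! ## §2 The massive flow `m ↦ Lm` -/

/-- The block-flow identity for King's kernel (part Ϻ-cc): `Σ_{a,b}K_{m²}(Lz+a, Lw+b) = L^{d+3}K_{L²m²}(z,w)`. [cite: King1986, §2 (2.3)–(2.6) p.652, Thm 2.1 (2.22) p.654] -/
theorem sum_sum_kingKernel_blockSite {m2 : ℝ} (hm : 0 < m2) {L : ℕ} (hL : 1 ≤ L) (z w : Fin (d + 1) → ℤ) :
    ∑ a : Fin (d + 1) → Fin L, ∑ b : Fin (d + 1) → Fin L, kingKernel m2 (blockSite L z a) (blockSite L w b) = (L : ℝ) ^ (d + 3) * kingKernel ((L : ℝ) ^ 2 * m2) z w := by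
  simp only [kingKernel_apply]
  have hdiff : ∀ a b : Fin (d + 1) → Fin L, blockSite L w b - blockSite L z a = fun μ => (L : ℤ) * (w - z) μ + ((b μ : ℕ) : ℤ) - ((a μ : ℕ) : ℤ) := by
    intro a b; funext μ; simp only [blockSite, Pi.sub_apply]; ring
  simp_rw [hdiff]
  rw [Finset.sum_comm]
  exact kingS2Inf_rg_flow hm hL (w - z)

/-- ★★★ **THE RENORMALISATION GROUP ACTS ON KING'S BLOCK FIELDS BY `m ↦ Lm`**: `(R_L)_*μ_{∞,m²} = μ_{∞,L²m²}` for every `d`, `m² > 0`, `L ≥ 1`.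
[cite: King1986, §2 (2.3)–(2.6) p.652, Thm 2.1 (2.22) p.654; Kallenberg2002, Lemma 13.1] -/
theorem kingFieldInf_map_blockRG {m2 : ℝ} (hm : 0 < m2) {L : ℕ} (hL : 1 ≤ L) :
    (kingFieldInf (d := d) m2).map (blockRG d L) = kingFieldInf ((L : ℝ) ^ 2 * m2) := by
  have hL0 : (0 : ℝ) < L := Nat.cast_pos.mpr (by omega)
  have hm' : 0 < (L : ℝ) ^ 2 * m2 := by positivity
  exact map_blockRG_gaussianFieldOfKernel (isPosSemidefKernel_kingKernel hm) (isPosSemidefKernel_kingKernel hm') hL (sum_sum_kingKernel_blockSite hm hL)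

/-- ★★ **ITERATION**: `(R_L^n)_*μ_{∞,m²} = μ_{∞,L^{2n}m²}` — `n` block-spin steps multiply the mass by `L^n`. [cite: King1986, §2 (2.3)–(2.6) p.652] -/
theorem kingFieldInf_map_blockRG_iterate {m2 : ℝ} (hm : 0 < m2) {L : ℕ} (hL : 1 ≤ L) (n : ℕ) :
    (kingFieldInf (d := d) m2).map ((blockRG d L)^[n]) = kingFieldInf (((L : ℝ) ^ 2) ^ n * m2) := by
  induction n generalizing m2 with
  | zero => simp
  | succ n ih =>
    have hL0 : (0 : ℝ) < L := Nat.cast_pos.mpr (by omega)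
    have hm' : 0 < (L : ℝ) ^ 2 * m2 := by positivity
    rw [Function.iterate_succ, ← Measure.map_map ((measurable_blockRG d L).iterate n) (measurable_blockRG d L), kingFieldInf_map_blockRG hm hL, ih hm']
    congr 1
    ring

/-! ## §3 The massless fixed point -/

/-- The block-flow identity for the massless kernel (part Ϻ-cc, `d ≥ 2`). [cite: King1986, §2 (2.3)–(2.6) p.652] -/
theorem sum_sum_kingKernel0_blockSite (hd : 2 ≤ d) {L : ℕ} (hL : 1 ≤ L) (z w : Fin (d + 1) → ℤ) :
    ∑ a : Fin (d + 1) → Fin L, ∑ b : Fin (d + 1) → Fin L, kingKernel0 (blockSite L z a) (blockSite L w b) = (L : ℝ) ^ (d + 3) * kingKernel0 z w := by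
  simp only [kingKernel0]
  have hdiff : ∀ a b : Fin (d + 1) → Fin L, blockSite L w b - blockSite L z a = fun μ => (L : ℤ) * (w - z) μ + ((b μ : ℕ) : ℤ) - ((a μ : ℕ) : ℤ) := by
    intro a b; funext μ; simp only [blockSite, Pi.sub_apply]; ring
  simp_rw [hdiff]
  rw [Finset.sum_comm]
  exact kingS2Inf0_rg_fixed_point hd hL (w - z)

/-- ★★★ **THE MASSLESS BLOCK FIELD IS A FIXED POINT OF THE BLOCK-SPIN RENORMALISATION GROUP**: `(R_L)_*μ⁰_∞ = μ⁰_∞` (`d + 1 ≥ 3`, every `L ≥ 1`).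
[cite: King1986, §2 (2.3)–(2.6) p.652, Thm 2.1 (2.22) p.654; Kallenberg2002, Lemma 13.1] -/
theorem kingFieldInf0_map_blockRG (hd : 2 ≤ d) {L : ℕ} (hL : 1 ≤ L) : (kingFieldInf0 d).map (blockRG d L) = kingFieldInf0 d :=
  map_blockRG_gaussianFieldOfKernel (isPosSemidefKernel_kingKernel0 hd) (isPosSemidefKernel_kingKernel0 hd) hL (sum_sum_kingKernel0_blockSite hd hL)

/-- `(R_L^n)_*μ⁰_∞ = μ⁰_∞`. [folklore] -/
theorem kingFieldInf0_map_blockRG_iterate (hd : 2 ≤ d) {L : ℕ} (hL : 1 ≤ L) (n : ℕ) : (kingFieldInf0 d).map ((blockRG d L)^[n]) = kingFieldInf0 d := by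
  induction n with
  | zero => simp
  | succ n ih =>
    rw [Function.iterate_succ, ← Measure.map_map ((measurable_blockRG d L).iterate n) (measurable_blockRG d L), kingFieldInf0_map_blockRG hd hL, ih]

end Summit.QuantumFields.YangMills.BalabanUVNodes.N15KingModelRung.InfiniteVolume
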